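import Summits.QuantumAdvantage.QuantumAdvantage.Theses.OddPrimeWalk

/-!
# Route OddPrimeWalk — support `DichotomyGlue` (item stmt-QuantumAdvantage-22729), proved

`DichotomyGlue := ShotsOdd → DenseResidualOdd → ∀ p prime, 5 ≤ p → WalkHardF p`: for a strategy `y` let
`b := max_u #{g : y_g(u) = 1}` (`Finset.univ.sup`); if `b³(log₂ n)^{2C+2} ≤ n` the shots rung applies with
`B := b` (every input fires `≤ b` cuts, `Finset.le_sup`), otherwise the dense residual applies; `θ := max θ₁ θ₂`,
`n₀ := max`.  Pure bookkeeping (planner qa-qnc0-p2 g14 pack; seat qa-qnc0-prover gen 10).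
-/

set_option linter.dupNamespace false

namespace Summit.QuantumAdvantage.QuantumAdvantage.Theorems

open Finset

/-- Item stmt-QuantumAdvantage-22729 `DichotomyGlue` of route OddPrimeWalk: the shots rung and the dense
residual together give `WalkHardF p` for every prime `p ≥ 5` (`θ := max θ₁ θ₂`; case split on
`b³(log₂ n)^{2C+2} ≤ n`, `b` the maximal shot count). -/
theorem dichotomyGlue_proof : Summit.QuantumAdvantage.QuantumAdvantage.Theses.OddPrimeWalk.DichotomyGlue := by
  intro hSh hR p _ hp
  obtain ⟨θ₁, hθ₁, h₁⟩ := hSh p hp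
  obtain ⟨θ₂, hθ₂, h₂⟩ := hR p hp
  refine ⟨max θ₁ θ₂, max_lt hθ₁ hθ₂, fun C => ?_⟩
  obtain ⟨n₁, hn₁⟩ := h₁ C
  obtain ⟨n₂, hn₂⟩ := h₂ C
  refine ⟨max n₁ n₂, fun n hn c y hy => ?_⟩
  have h2n : (0 : ℝ) ≤ (2 : ℝ) ^ n := by positivity
  -- the maximal shot count
  set b : ℕ := univ.sup fun u : Fin n → Bool => (univ.filter fun g : Fin (n + 1) => y g u = true).card
    with hb
  by_cases hcase : b ^ 3 * (Nat.log 2 n) ^ (2 * C + 2) ≤ n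
  · have hshots : ∀ u : Fin n → Bool, (univ.filter fun g : Fin (n + 1) => y g u = true).card ≤ b :=
      fun u => Finset.le_sup (f := fun u : Fin n → Bool =>
        (univ.filter fun g : Fin (n + 1) => y g u = true).card) (mem_univ u)
    have h := hn₁ n (le_trans (le_max_left _ _) hn) c b y hy hshots hcase
    exact h.trans (mul_le_mul_of_nonneg_right (le_max_left _ _) h2n)
  · have h := hn₂ n (le_trans (le_max_right _ _) hn) c y hy hcase
    exact h.trans (mul_le_mul_of_nonneg_right (le_max_right _ _) h2n)

end Summit.QuantumAdvantage.QuantumAdvantage.Theorems
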